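import Summits.QuantumFields.YangMills.Theorems.BalabanUVNodesK1EndOfNodes13PWSOfRunRemAt
import Summits.QuantumFields.YangMills.Theorems.BalabanUVNodesN13NodeAtRevisedRecordWorldAtRecord13SepCoPHV

/-!
# BalabanUVNodes ∕ K1⁹ — THE BODY OF `StabilityBRunRowsAtRecordR13SepCoPHV` AT A WORLD BOUND TO THE REVISED RECORD DATUM («LINE 2»: the `RecordSⱽ`-world edition of stubs 1 ∕ 2″ ∕ 3,
# composed): nodes at a world with `w.C = (datumOfRecord₁₃SepCoPHV F N θ h v).C` + the run letters of `β_θ` ⟹ (B) AT THE REVISED DATUM ∧ its window; hence K1⁹ BY NAME from the three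
# `RecordSⱽ`-world stub texts — dag-n24-w1's END road (p598782 §2) re-run at the version slot, NO new estimate
# (Track A; cluster K1 — K1⁹ `StabilityBRunRowsAtRecordR13SepCoPHV` = stmt-QuantumFields-26907's successor stmt-QuantumFields-27364, helper; seat `pub-ymgap-dag-n13-w3` g4 (N13 [B16]); plan g85's K1 «v8ʳᵉᶠˡ»
# header: «LINE 2 (the slot INSIDE the rows rung: an `RecordSⱽ`-world edition of stubs 1∕2″ …) is the K1∕N13 lanes' to type»; 2026-08-28; count-neutral)

HONEST FRAMING.  Count-neutral kernel COMPOSITION; nothing of Bałaban's is asserted or refuted; NO stub closed.  The registered K1⁹ skeleton «v8ʳᵉᶠˡ» (af6142d41a059787) fills the version slot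
with `Revision₁₃.refl`, so its stub 1∕2″ world `RecordS F θ h w` still binds `w.C` to the UNREVISED datum — whose (B)∕Cor-3 face at levels ≥ 1 is decided by density versions (dag-n13-w2 p617654,
director-ym №210).  THIS FILE types the composition of the `RecordSⱽ` edition — the world bound to `datumOfRecord₁₃SepCoPHV F N θ h v` for SOME slot `v` — so that a «LINE 2» skeleton can ask
the thirteen nodes at a REVISED world (N13 there = (0.1) pointwise on the RE-CHOSEN densities, supplied from Theorem 1 + the version-free rows by the slot chain and this seat's
`…N13NodeAtRevisedRecordWorldAtRecord13SepCoPHV` p624688) and still conclude K1⁹ BY NAME: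
* §1 ★★★ `endStatementBPrinted_window_at_recordV_of_nodes_of_runLetters` — `D := datumOfRecord₁₃SepCoPHV θ h v`; the REBOUND twin `{w with C := (datumOfRecord₁₃SepCoPH θ h).C}` in dag-n10-d's
  S-class `IsRecordOfRecord₁₃CSepCoPHS` (it supplies the (0.20) guard, which reads the FLOW only — identical at `datumⱽ`, DEF-1's `rfl` faces), `w.C = D.C`, the thirteen nodes at EVERY run of `w`,
  and dag-n24-w1's run letters for `D.βfun = betaOfRecord₁₃ θ` (run-wise constant remainder `RunConstRemainder`, `b ≤ B`, match `B + r ≤ w.βup`, run-wise (PS) floor) ⟹ `B16.EndStatementBPrinted D.C`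
  ∧ the `K ≥ 1` window at `D` — p598782's `endStatementBPrinted_window_of_isRecordOfRecord₁₃CSepCoPHS_of_nodes_of_runLetters` RE-RUN VERBATIM at `D` (same `c₀`, same re-lettering `γ₁ := min (min w.γ γ₀)
  √(c₀∕(M+1))`, END by `endStatementBPrinted_of_nodesP_alongRuns_partialSums`, window by dag-n13-w4's `window_of_frequently_beta_le`).
* §2 ★★★ `stabilityBV_body_of_rung1AtV_of_runLetters` — θ-keyed: unity ∧ slots, admissibility, the `RecordSⱽ` text «`∃ θ' h'`, admissible, same datum, `w.C = (datumⱽ v).C`, window `0 < w.γ ≤ θ'.γ`,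
  `w.L = θ'.L`, S-binding `w.up P = upOfRecord₅CS …`» (v8's `RecordS` with ONE token changed), the nodes, the run letters ⟹ the (B)+window BODY OF K1⁹ at the witness `(θ, h, v)`.
* §3 ★★★ `stabilityBRunRowsAtRecordR13SepCoPHV_of_stubTextsV` — THE ROUTE DECL BY NAME from the three `RecordSⱽ`-world stub TEXTS (v8's `Inhabited13` ⟶ `NodesAtSomeRecord13PWSⱽ` ⟶
  `RunRowsAtSomeRecord13PWSⱽ` ⟶ `RunRowsContAtSomeRecord13PWSⱽ`, spelled inline; rows (i)(iv)(C) θ-level as in v8) — the candidate registered composition of a «LINE 2» skeleton.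
  (+ `stabilityBRunRowsAtRecordR13SepCoPHV_byName_of_rowsContWitnessV`: the same from the LAST RUNG of an ∃→∃ stub chain — v8's `k1R9_of_stubs` with the `refl` door replaced by the witness's slot).
* §4 ★★ `stabilityBV_body_of_rung1AtV_of_nodesRebound_of_cor3With_of_runLetters` — N13's entry at the revised world discharged by p624688 §5: the thirteen nodes at the REBOUND twin (any road, e.g. the
  engines' at the record — N13 there is dropped, only the other twelve are used) + the 𝐑-leaf `(w.up P).rOperation` (binding-agnostic) + `B16.Cor3With (datumⱽ v).C γ₁ w.em w.ep` + `w.γ ≤ γ₁`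
  ⟹ the body (`b16_main_at_recordV₁₃_of_rOperation_of_cor3With`); so on LINE 2 the UNREVISED N13 pin is never asked.
WHAT IS DISPLAYED (LOCATED): every hypothesis — the nodes, the run letters ([I] Thm 3 p.264 ∕ (5.10); [II] (2.41); unprinted as theorems of the series), `Cor3With` at the revised datum (= the
K1⁹ (B)-slot's one open analytic entry at levels ≥ 1: (2.50) a.e. ∕ in measure, Bałaban's theorem proper at the tree's selector laws) — is nobody's theorem here.  No stub of v8 closed; K1⁹ ∕ K3⁸ ∕
K0⁷ OPEN; N13 NOT discharged; counts unmoved (typed 28∕28 · discharged 5∕27 · Track A 5∕28).  ONE finite four-torus programme at fixed `ε = L^{−K}`, Bałaban AS PRINTED; R4 closes the conditional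
finite-𝕋⁴ rung `BalabanLadder.UV` only — the Yang–Mills mass gap (Clay) is NOT proved by any of this; nothing continuum ∕ ℝ⁴ ∕ OS.  No `sorry`, `def`, `instance`, `notation`.

Sources: [Balaban1989LargeFieldII] Thm 1 + (0.1) pp.355–356, p.391; [Balaban1988Convergent] (2.6) p.255, Cor. 3 (2.50) p.264; [Balaban1987RG1] (0.17)–(0.20) pp.255–256, Thm 2 p.259,
(1.20)–(1.22) p.264, Thm 3 p.264, (5.10) p.293; [Balaban1988RG2Cluster] (2.41) p.21 (statement shapes only).
-/

noncomputable section

open scoped Matrix.Norms.L2Operator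
open Filter Topology

namespace Summit.QuantumFields.YangMills.BalabanUVNodes.K1R9BodyAtRevisedRecordWorldOfNodesRunLetters

open Literature.MathematicalPhysics.QuantumFieldTheory.Balaban1983to89
open Literature.MathematicalPhysics.QuantumFieldTheory.Balaban1983to89.Node00
open DagBinding T4Continuum T4DatumAssembly FlowStepRuns
open FlowStep (HBeta RGEqH prefixOf)
open Summit.QuantumFields.YangMills.Theorems.BalabanUVNodesK2NamedJetsRunRemAt (RunConstRemainder SurvCont)
open Summit.QuantumFields.YangMills.BalabanUVNodes.K1BetaWindow13SOfNodes13PWSOfBoxH (nodes_leavesP_reletter_of_le_all isRecordOfRecord₁₃CSepCoPHS_reletter_of_le)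
open Summit.QuantumFields.YangMills.BalabanUVNodes.K1EndOfNodes13PWSOfPartialSums (endStatementBPrinted_of_nodesP_alongRuns_partialSums)
open Summit.QuantumFields.YangMills.Theorems.BalabanUVNodesK1WindowExactCriterion (window_of_frequently_beta_le)
open Summit.QuantumFields.YangMills.BalabanUVNodes.K1EndOfNodes13PWSOfRunRemAt (upper_alongRun_of_runConstRemainder partialSums_alongRun_of_runwisePS frequently_betaZero_le_of_runConstRemainder)
open Summit.QuantumFields.YangMills.BalabanUVNodes.N13NodeAtRevisedRecordWorldAtRecord13SepCoPHV (nodes_at_recordV₁₃_of_nodes_rebound_of_b16 uvIneq_revision₁₃_iff flow_inInterval_revision₁₃_iff)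
open B16NodeKnitRepTowerOfRecord (uvSlot_at_construction)
open B16NodeKnitRecord5 (b16_main_of_rOperation_of_uvSlot)

variable {F : T4Family} {N : ℕ} [NeZero N]

/-! ## §1. ★★★ (B) + window AT THE REVISED DATUM from nodes at a world bound to it and the run letters (p598782 §2 re-run at the slot) -/

section EndV

variable (θ : Stage13HParams F N) (h : θ.Provisos₁₃SepCoPH F N) (v : Revision₁₃ F N θ h) (w : WorldP)

/-- **★★★ END + WINDOW AT THE REVISED RECORD DATUM `D := datumOfRecord₁₃SepCoPHV θ h v` FROM THE NODES AT A WORLD BOUND TO IT AND RUN LETTERS ONLY.**  Inputs: the REBOUND twin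
`{w with C := (datumOfRecord₁₃SepCoPH θ h).C}` is an S-class record (dag-n10-d's `IsRecordOfRecord₁₃CSepCoPHS`: presenting parameters, window `0 < w.γ`, block size, S-binding — it supplies the
guarded (0.20) leaf, which reads the flow only and is therefore the SAME at the revised world); `w.C = D.C`; the thirteen DAG nodes at every run of `w`; on SOME level `γ₀ > 0` the run-wise constant
remainder of `D.βfun` relative to a reference sequence bounded by `B`, the numeric ceiling match `B + r ≤ w.βup`, the run-wise (PS) floor.  Output: `B16.EndStatementBPrinted D.C` and the `K ≥ 1`
window at `D`.  Road = p598782 §2 VERBATIM (`M ≥ 0`; `c₀ := 1 − (1+w.β₀)⁻²`; `γ₁ := min (min w.γ γ₀) √(c₀∕(M+1))`; nodes re-lettered; END along runs; window from the level-0 β bound).  CONDITIONAL;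
nothing of Bałaban asserted; no stub closed. [cite: Balaban1989LargeFieldII, Thm 1 p.355 + (0.1) pp.355–356 + p.391; Balaban1988Convergent, (2.6) p.255, Cor. 3 (2.50) p.264; Balaban1987RG1, (0.17)–(0.20) pp.255–256, Thm 2 p.259, §1 (1.22) p.264, Thm 3 p.264] -/
theorem endStatementBPrinted_window_at_recordV_of_nodes_of_runLetters
    (hR₀ : IsRecordOfRecord₁₃CSepCoPHS F N (datumOfRecord₁₃SepCoPH F N θ h) { w with C := (datumOfRecord₁₃SepCoPH F N θ h).C })
    (hC : w.C = (datumOfRecord₁₃SepCoPHV F N θ h v).C) (hnodes : ∀ P : B12.RunParams, Nodes (leavesP w P))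
    {b : ℕ → ℝ} {r γ₀ B M : ℝ} (hγ₀ : 0 < γ₀) (hrem : RunConstRemainder (datumOfRecord₁₃SepCoPHV F N θ h v).βfun b r γ₀) (hB : ∀ k, b k ≤ B) (hmatch : B + r ≤ w.βup)
    (hps : ∀ (n : ℕ) (gs : ℕ → ℝ), RGEqH n (datumOfRecord₁₃SepCoPHV F N θ h v).βfun gs → Step.InInterval γ₀ n gs →
      ∀ k, k ≤ n → -M ≤ ∑ j ∈ Finset.Ico k n, (datumOfRecord₁₃SepCoPHV F N θ h v).βfun j (prefixOf gs j)) :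
    B16.EndStatementBPrinted (datumOfRecord₁₃SepCoPHV F N θ h v).C ∧
      ∃ γ₁ : ℝ, 0 < γ₁ ∧ ∀ γ : ℝ, 0 < γ → γ ≤ γ₁ → ∃ P : B12.RunParams, 1 ≤ P.K ∧ ((datumOfRecord₁₃SepCoPHV F N θ h v).C P).flow.InInterval γ P.K := by
  have hγw : 0 < w.γ := by
    have hγ' := gamma_pos_of_isRecordOfRecord₁₃CSepCoPHS hR₀
    exact hγ'
  -- M ≥ 0 from the empty sum along the one-point run `(γ₀)`
  have hM : 0 ≤ M := by
    have hRG : RGEqH 0 (datumOfRecord₁₃SepCoPHV F N θ h v).βfun (fun _ => γ₀) := fun k hk => absurd hk (Nat.not_lt_zero k)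
    have hI : Step.InInterval γ₀ 0 (fun _ => γ₀) := fun _ _ => ⟨hγ₀, le_rfl⟩
    have h0 := hps 0 (fun _ => γ₀) hRG hI 0 le_rfl
    simp only [Finset.Ico_self, Finset.sum_empty] at h0
    linarith
  -- the smallness constant and the shrunk window
  set c₀ : ℝ := 1 - ((1 + w.β₀) ^ 2)⁻¹ with hc₀_def
  have hc₀ : 0 < c₀ := by
    have h1 : 1 < (1 + w.β₀) ^ 2 := by nlinarith [w.β₀_pos]
    have h2 : ((1 + w.β₀) ^ 2)⁻¹ < 1 := inv_lt_one_of_one_lt₀ h1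
    rw [hc₀_def]; linarith
  set γM : ℝ := Real.sqrt (c₀ / (M + 1)) with hγM_def
  have hγM : 0 < γM := Real.sqrt_pos.mpr (by positivity)
  set γ₁ : ℝ := min (min w.γ γ₀) γM with hγ₁_def
  have hγ₁ : 0 < γ₁ := lt_min (lt_min hγw hγ₀) hγM
  have hγ₁w : γ₁ ≤ w.γ := (min_le_left _ _).trans (min_le_left _ _)
  have hγ₁₀ : γ₁ ≤ γ₀ := (min_le_left _ _).trans (min_le_right _ _)
  have hsmall : M * γ₁ ^ 2 ≤ c₀ := by
    have h1 : γ₁ ^ 2 ≤ γM ^ 2 := pow_le_pow_left₀ hγ₁.le (min_le_right _ _) 2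
    have h2 : γM ^ 2 = c₀ / (M + 1) := by rw [hγM_def, Real.sq_sqrt (by positivity)]
    have h3 : M * (c₀ / (M + 1)) ≤ c₀ := by
      rw [mul_div_assoc']
      rw [div_le_iff₀ (by positivity)]
      nlinarith [hc₀, hM]
    calc M * γ₁ ^ 2 ≤ M * γM ^ 2 := mul_le_mul_of_nonneg_left h1 hM
      _ = M * (c₀ / (M + 1)) := by rw [h2]
      _ ≤ c₀ := h3
  -- the guard at the re-lettered REVISED world from the re-lettered REBOUND twin's S-class (the (0.20) leaf reads the flow only)
  have hR₀' : IsRecordOfRecord₁₃CSepCoPHS F N (datumOfRecord₁₃SepCoPH F N θ h)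
      { ({ w with C := (datumOfRecord₁₃SepCoPH F N θ h).C } : WorldP) with γ := γ₁, b := w.b, b_pos := w.b_pos } :=
    isRecordOfRecord₁₃CSepCoPHS_reletter_of_le hR₀ hγ₁ hγ₁w w.b_pos
  have hguard : ∀ P : B12.RunParams, (leavesP ({ w with γ := γ₁, b := w.b, b_pos := w.b_pos } : WorldP) P).smallCouplings →
      (leavesP ({ w with γ := γ₁, b := w.b, b_pos := w.b_pos } : WorldP) P).rgFlow := by
    intro P hsc
    have hsc' : (leavesP ({ ({ w with C := (datumOfRecord₁₃SepCoPH F N θ h).C } : WorldP) with γ := γ₁, b := w.b, b_pos := w.b_pos } : WorldP) P).smallCouplings := by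
      change ((datumOfRecord₁₃SepCoPH F N θ h).C P).flow.InInterval γ₁ P.K
      change (w.C P).flow.InInterval γ₁ P.K at hsc
      rw [hC] at hsc
      exact hsc
    have h' := rgFlow_of_smallCouplings_of_isRecordOfRecord₁₃CSepCoPHS hR₀' P hsc'
    change ((datumOfRecord₁₃SepCoPH F N θ h).C P).flow.SatisfiesRG P.K at h'
    change (w.C P).flow.SatisfiesRG P.K
    rw [hC]
    exact h'
  -- the END along runs at the re-lettered revised world
  have hEND : B16.EndStatementBPrinted ({ w with γ := γ₁, b := w.b, b_pos := w.b_pos } : WorldP).C := by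
    refine endStatementBPrinted_of_nodesP_alongRuns_partialSums { w with γ := γ₁, b := w.b, b_pos := w.b_pos } hγ₁ (M := M)
      (nodes_leavesP_reletter_of_le_all w hγ₁w w.b_pos hnodes) hguard (fun P hsc => ?_) (fun P hsc => ?_) hsmall
    · have hrgP : ((datumOfRecord₁₃SepCoPHV F N θ h v).C.toB12 P).flow.SatisfiesRG P.K := by
        have h' := hguard P hsc
        show ((datumOfRecord₁₃SepCoPHV F N θ h v).C P).flow.SatisfiesRG P.K
        rw [← hC]; exact h'
      have hsc' : ((datumOfRecord₁₃SepCoPHV F N θ h v).C.toB12 P).flow.InInterval γ₁ P.K := by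
        show ((datumOfRecord₁₃SepCoPHV F N θ h v).C P).flow.InInterval γ₁ P.K
        rw [← hC]; exact hsc
      show ∀ j, j < P.K → (w.C P).flow.β (j + 1) ((w.C P).flow.g j) ≤ w.βup
      rw [hC]
      exact fun j hj => (upper_alongRun_of_runConstRemainder (datumOfRecord₁₃SepCoPHV F N θ h v).C.toB12 (datumOfRecord₁₃SepCoPHV F N θ h v).βfun
        (datumOfRecord₁₃SepCoPHV F N θ h v).curries hγ₁₀ hrem hB P hrgP hsc' j hj).trans hmatch
    · have hrgP : ((datumOfRecord₁₃SepCoPHV F N θ h v).C.toB12 P).flow.SatisfiesRG P.K := by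
        have h' := hguard P hsc
        show ((datumOfRecord₁₃SepCoPHV F N θ h v).C P).flow.SatisfiesRG P.K
        rw [← hC]; exact h'
      have hsc' : ((datumOfRecord₁₃SepCoPHV F N θ h v).C.toB12 P).flow.InInterval γ₁ P.K := by
        show ((datumOfRecord₁₃SepCoPHV F N θ h v).C P).flow.InInterval γ₁ P.K
        rw [← hC]; exact hsc
      show ∀ m n, m ≤ n → n ≤ P.K → -M ≤ ∑ j ∈ Finset.Ico m n, (w.C P).flow.β (j + 1) ((w.C P).flow.g j)
      rw [hC]
      exact partialSums_alongRun_of_runwisePS (datumOfRecord₁₃SepCoPHV F N θ h v).C.toB12 (datumOfRecord₁₃SepCoPHV F N θ h v).βfun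
        (datumOfRecord₁₃SepCoPHV F N θ h v).curries hγ₁₀ hps P hrgP hsc'
  refine ⟨?_, window_of_frequently_beta_le (datumOfRecord₁₃SepCoPHV F N θ h v) (frequently_betaZero_le_of_runConstRemainder hγ₀ hrem)⟩
  have : ({ w with γ := γ₁, b := w.b, b_pos := w.b_pos } : WorldP).C = (datumOfRecord₁₃SepCoPHV F N θ h v).C := hC
  rw [← this]
  exact hEND

end EndV

/-! ## §2. ★★★ θ-keyed: the (B)+window BODY OF K1⁹ at the witness `(θ, h, v)` from a `RecordSⱽ` world with the nodes and the run letters of `β_θ` -/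

section BodyV

/-- **★★★ THE BODY OF K1⁹ AT ITS WITNESS FROM A `RecordSⱽ`-WORLD** (the V-twin of p598782's `stabilityB_body_of_rung1At_of_runLetters`): unity ∧ slots, admissibility, the `RecordSⱽ` text (v8's
`RecordS` with ONE token changed: `w.C = (datumOfRecord₁₃SepCoPHV F N θ h v).C` — presenting admissible `θ'` of the SAME datum, window `0 < w.γ ≤ θ'.γ`, `w.L = θ'.L`, S-binding of record),
the thirteen nodes at every run, and on SOME level `γ₀ > 0` dag-n24-w1's run letters for `betaOfRecord₁₃ θ` (= the revised datum's `βfun`, DEF-1's `rfl` face) ⟹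
`(unity ∧ slots) ∧ Admissible ∧ B16.EndStatementBPrinted (datumOfRecord₁₃SepCoPHV F N θ h v).C ∧` the `K ≥ 1` window there.  CONDITIONAL; closes nothing.
[cite: Balaban1989LargeFieldII, Thm 1 p.355 + (0.1) pp.355–356 + p.391; Balaban1988Convergent, (2.6) p.255, Cor. 3 (2.50) p.264; Balaban1987RG1, (0.20) p.256, Thm 2 p.259, Thm 3 p.264 (bookkeeping)] -/
theorem stabilityBV_body_of_rung1AtV_of_runLetters (θ : Stage13HParams F N) (h : θ.Provisos₁₃SepCoPH F N) (v : Revision₁₃ F N θ h) (w : WorldP)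
    (hU : θ.ZhUnity F N ∧ θ.SlotsNondegenerate₁₃ F N) (hθ : θ.Admissible F N)
    (hRV : ∃ (θ' : Stage13HParams F N) (h' : θ'.Provisos₁₃SepCoPH F N), θ'.Admissible F N ∧
      datumOfRecord₁₃SepCoPH F N θ h = datumOfRecord₁₃SepCoPH F N θ' h' ∧ w.C = (datumOfRecord₁₃SepCoPHV F N θ h v).C ∧ (0 < w.γ ∧ w.γ ≤ θ'.γ) ∧
      w.L = (θ'.L : ℝ) ∧ ∀ P : B12.RunParams, w.up P = upOfRecord₅CS F N (θ'.toStage5₁₃CoPH F N) P)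
    (hnodes : ∀ P : B12.RunParams, Nodes (leavesP w P))
    {b : ℕ → ℝ} {r γ₀ B M : ℝ} (hγ₀ : 0 < γ₀) (hrem : RunConstRemainder (betaOfRecord₁₃ F N θ.toStage13Params) b r γ₀) (hB : ∀ k, b k ≤ B) (hmatch : B + r ≤ w.βup)
    (hps : ∀ (n : ℕ) (gs : ℕ → ℝ), RGEqH n (betaOfRecord₁₃ F N θ.toStage13Params) gs → Step.InInterval γ₀ n gs →
      ∀ k, k ≤ n → -M ≤ ∑ j ∈ Finset.Ico k n, betaOfRecord₁₃ F N θ.toStage13Params j (prefixOf gs j)) :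
    (θ.ZhUnity F N ∧ θ.SlotsNondegenerate₁₃ F N) ∧ θ.Admissible F N ∧ B16.EndStatementBPrinted (datumOfRecord₁₃SepCoPHV F N θ h v).C ∧
      ∃ γ₁ : ℝ, 0 < γ₁ ∧ ∀ γ : ℝ, 0 < γ → γ ≤ γ₁ → ∃ P : B12.RunParams, 1 ≤ P.K ∧ ((datumOfRecord₁₃SepCoPHV F N θ h v).C P).flow.InInterval γ P.K := by
  obtain ⟨θ', h', hθ', hD, hC, hγ, hL, hup⟩ := hRV
  have hR₀ : IsRecordOfRecord₁₃CSepCoPHS F N (datumOfRecord₁₃SepCoPH F N θ h) { w with C := (datumOfRecord₁₃SepCoPH F N θ h).C } :=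
    ⟨θ', h', hθ', hD, rfl, hγ, hL, hup⟩
  exact ⟨hU, hθ, endStatementBPrinted_window_at_recordV_of_nodes_of_runLetters θ h v w hR₀ hC hnodes hγ₀ hrem hB hmatch hps⟩

end BodyV

/-! ## §3. ★★★ K1⁹ BY NAME from the three `RecordSⱽ`-world stub texts («LINE 2»'s candidate registered composition) -/

section Line2

/-- **★★★ THE ROUTE DECL `StabilityBRunRowsAtRecordR13SepCoPHV` (K1⁹, stmt-QuantumFields-27364) FROM THE THREE `RecordSⱽ`-WORLD STUB TEXTS** (spelled inline; `N = 2`): stub 1ⱽ «rung 0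
(`Inhabited13`) ⟹ SOME unity∕slots∕admissible `(θ, h)`, SOME slot `v : Revision₁₃ F 2 θ h`, SOME `RecordSⱽ` world `w` of the REVISED datum with the thirteen nodes at every run (N08 pinned
`PrintedUV3V`, N12's [IV] basic step keyed at a genuine step — v8's texts with the one-token change)», stub 2″ⱽ «⟹ the same data + the RUN ROWS of `β_θ` (v6 currency: `RunConstRemainder`,
`b ≤ B`, `B + r ≤ w.βup`, run-wise (PS) floor)», stub 3ⱽ «⟹ the same + (C) `SurvCont β_θ γ₀`» — composed by §2 at the witness; rows (i)(iv)(C) read off the last rung.  The proof term is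
the v8 composition `k1R9_of_stubs` with the `refl` door replaced by the witness's own slot.  This is a CANDIDATE composition for a «LINE 2» skeleton (plan g85's K1 v8 header); it is NOT a
registered skeleton and closes NO stub. [cite: Balaban1989LargeFieldII, Thm 1 + (0.1) pp.355–356; Balaban1987RG1, Thm 3 p.264, (1.20)–(1.22) p.264, (5.10) p.293, §1 pp.263–264; Balaban1988RG2Cluster, (2.41) p.21 (statement shapes only)] -/
theorem stabilityBRunRowsAtRecordR13SepCoPHV_of_stubTextsV {F : T4Family}
    (h₁ : (∃ θ : Stage13HParams F 2, θ.Provisos₁₃SepCoPH F 2 ∧ (θ.ZhUnity F 2 ∧ θ.SlotsNondegenerate₁₃ F 2) ∧ θ.Admissible F 2) →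
      ∃ (θ : Stage13HParams F 2) (h : θ.Provisos₁₃SepCoPH F 2) (v : Revision₁₃ F 2 θ h) (w : WorldP), (θ.ZhUnity F 2 ∧ θ.SlotsNondegenerate₁₃ F 2) ∧ θ.Admissible F 2 ∧
        (∃ (θ' : Stage13HParams F 2) (h' : θ'.Provisos₁₃SepCoPH F 2), θ'.Admissible F 2 ∧
          datumOfRecord₁₃SepCoPH F 2 θ h = datumOfRecord₁₃SepCoPH F 2 θ' h' ∧ w.C = (datumOfRecord₁₃SepCoPHV F 2 θ h v).C ∧ (0 < w.γ ∧ w.γ ≤ θ'.γ) ∧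
          w.L = (θ'.L : ℝ) ∧ ∀ P : B12.RunParams, w.up P = upOfRecord₅CS F 2 (θ'.toStage5₁₃CoPH F 2) P) ∧
        (∀ P : B12.RunParams, Nodes (leavesP w P)) ∧ PrintedUV3V 2 θ.L ∧
        ∃ lam : ResidW F 2, (∀ P : B12.RunParams, 1 ≤ P.K → lam.kSel P < P.K) ∧
          ∀ P : B12.RunParams, lam.kSel P < P.K → ((leavesP w P).rBasicStep ↔ B15Leaf (WOfRecord₁₃ F 2 θ.toStage13Params lam P)))
    (h₂ : ∀ (θ : Stage13HParams F 2) (h : θ.Provisos₁₃SepCoPH F 2) (v : Revision₁₃ F 2 θ h) (w : WorldP), (θ.ZhUnity F 2 ∧ θ.SlotsNondegenerate₁₃ F 2) → θ.Admissible F 2 →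
      (∃ (θ' : Stage13HParams F 2) (h' : θ'.Provisos₁₃SepCoPH F 2), θ'.Admissible F 2 ∧
          datumOfRecord₁₃SepCoPH F 2 θ h = datumOfRecord₁₃SepCoPH F 2 θ' h' ∧ w.C = (datumOfRecord₁₃SepCoPHV F 2 θ h v).C ∧ (0 < w.γ ∧ w.γ ≤ θ'.γ) ∧
          w.L = (θ'.L : ℝ) ∧ ∀ P : B12.RunParams, w.up P = upOfRecord₅CS F 2 (θ'.toStage5₁₃CoPH F 2) P) →
      (∀ P : B12.RunParams, Nodes (leavesP w P)) →
      ∃ (b : ℕ → ℝ) (r γ₀ B M : ℝ), 0 < γ₀ ∧ RunConstRemainder (betaOfRecord₁₃ F 2 θ.toStage13Params) b r γ₀ ∧ (∀ k, b k ≤ B) ∧ B + r ≤ w.βup ∧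
        (∀ (n : ℕ) (gs : ℕ → ℝ), RGEqH n (betaOfRecord₁₃ F 2 θ.toStage13Params) gs → Step.InInterval γ₀ n gs →
          ∀ k, k ≤ n → -M ≤ ∑ j ∈ Finset.Ico k n, betaOfRecord₁₃ F 2 θ.toStage13Params j (prefixOf gs j)) ∧
        SurvCont (betaOfRecord₁₃ F 2 θ.toStage13Params) γ₀)
    (hinh : ∃ θ : Stage13HParams F 2, θ.Provisos₁₃SepCoPH F 2 ∧ (θ.ZhUnity F 2 ∧ θ.SlotsNondegenerate₁₃ F 2) ∧ θ.Admissible F 2) :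
    ∃ (θ : Stage13HParams F 2) (h : θ.Provisos₁₃SepCoPH F 2) (v : Revision₁₃ F 2 θ h), (θ.ZhUnity F 2 ∧ θ.SlotsNondegenerate₁₃ F 2) ∧ θ.Admissible F 2 ∧
      B16.EndStatementBPrinted (datumOfRecord₁₃SepCoPHV F 2 θ h v).C ∧
      (∃ γ₁ : ℝ, 0 < γ₁ ∧ ∀ γ : ℝ, 0 < γ → γ ≤ γ₁ → ∃ P : B12.RunParams, 1 ≤ P.K ∧ ((datumOfRecord₁₃SepCoPHV F 2 θ h v).C P).flow.InInterval γ P.K) ∧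
      ∃ (b : ℕ → ℝ) (r γ₀ M : ℝ), 0 < γ₀ ∧ RunConstRemainder (betaOfRecord₁₃ F 2 θ.toStage13Params) b r γ₀ ∧
        (∀ (n : ℕ) (gs : ℕ → ℝ), RGEqH n (betaOfRecord₁₃ F 2 θ.toStage13Params) gs → Step.InInterval γ₀ n gs →
          ∀ k, k ≤ n → -M ≤ ∑ j ∈ Finset.Ico k n, betaOfRecord₁₃ F 2 θ.toStage13Params j (prefixOf gs j)) ∧
        SurvCont (betaOfRecord₁₃ F 2 θ.toStage13Params) γ₀ := by
  obtain ⟨θ, h, v, w, hU, hθ, hRV, hnodes, -, -⟩ := h₁ hinh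
  obtain ⟨b, r, γ₀, B, M, hγ₀, hrem, hB, hmatch, hps, hsc⟩ := h₂ θ h v w hU hθ hRV hnodes
  obtain ⟨hU', hθ', hb, hwin⟩ := stabilityBV_body_of_rung1AtV_of_runLetters θ h v w hU hθ hRV hnodes hγ₀ hrem hB hmatch hps
  exact ⟨θ, h, v, hU', hθ', hb, hwin, b, r, γ₀, M, hγ₀, hrem, hps, hsc⟩

/-- **★★★ … hence THE ROUTE DECL BY NAME** from the two `RecordSⱽ`-world stub texts of §3 taken at every `F` (stub 1ⱽ, and stubs 2″ⱽ∘3ⱽ merged into the rows+(C) letter at the rung-1 data):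
`Summit.QuantumFields.YangMills.Theses.BalabanUVNodes.StabilityBRunRowsAtRecordR13SepCoPHV` (rev 28∕29, stmt-QuantumFields-27364).  CONDITIONAL on the stub texts; closes NO stub; the v8
skeleton of record is untouched. [cite: Balaban1989LargeFieldII, Thm 1 + (0.1) pp.355–356; Balaban1987RG1, Thm 3 p.264, §1 pp.263–264 (statement shapes only)] -/
theorem stabilityBRunRowsAtRecordR13SepCoPHV_byName_of_stubTextsV
    (h₁ : ∀ F : T4Family, (∃ θ : Stage13HParams F 2, θ.Provisos₁₃SepCoPH F 2 ∧ (θ.ZhUnity F 2 ∧ θ.SlotsNondegenerate₁₃ F 2) ∧ θ.Admissible F 2) →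
      ∃ (θ : Stage13HParams F 2) (h : θ.Provisos₁₃SepCoPH F 2) (v : Revision₁₃ F 2 θ h) (w : WorldP), (θ.ZhUnity F 2 ∧ θ.SlotsNondegenerate₁₃ F 2) ∧ θ.Admissible F 2 ∧
        (∃ (θ' : Stage13HParams F 2) (h' : θ'.Provisos₁₃SepCoPH F 2), θ'.Admissible F 2 ∧
          datumOfRecord₁₃SepCoPH F 2 θ h = datumOfRecord₁₃SepCoPH F 2 θ' h' ∧ w.C = (datumOfRecord₁₃SepCoPHV F 2 θ h v).C ∧ (0 < w.γ ∧ w.γ ≤ θ'.γ) ∧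
          w.L = (θ'.L : ℝ) ∧ ∀ P : B12.RunParams, w.up P = upOfRecord₅CS F 2 (θ'.toStage5₁₃CoPH F 2) P) ∧
        (∀ P : B12.RunParams, Nodes (leavesP w P)) ∧ PrintedUV3V 2 θ.L ∧
        ∃ lam : ResidW F 2, (∀ P : B12.RunParams, 1 ≤ P.K → lam.kSel P < P.K) ∧
          ∀ P : B12.RunParams, lam.kSel P < P.K → ((leavesP w P).rBasicStep ↔ B15Leaf (WOfRecord₁₃ F 2 θ.toStage13Params lam P)))
    (h₂ : ∀ (F : T4Family) (θ : Stage13HParams F 2) (h : θ.Provisos₁₃SepCoPH F 2) (v : Revision₁₃ F 2 θ h) (w : WorldP), (θ.ZhUnity F 2 ∧ θ.SlotsNondegenerate₁₃ F 2) → θ.Admissible F 2 →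
      (∃ (θ' : Stage13HParams F 2) (h' : θ'.Provisos₁₃SepCoPH F 2), θ'.Admissible F 2 ∧
          datumOfRecord₁₃SepCoPH F 2 θ h = datumOfRecord₁₃SepCoPH F 2 θ' h' ∧ w.C = (datumOfRecord₁₃SepCoPHV F 2 θ h v).C ∧ (0 < w.γ ∧ w.γ ≤ θ'.γ) ∧
          w.L = (θ'.L : ℝ) ∧ ∀ P : B12.RunParams, w.up P = upOfRecord₅CS F 2 (θ'.toStage5₁₃CoPH F 2) P) →
      (∀ P : B12.RunParams, Nodes (leavesP w P)) →
      ∃ (b : ℕ → ℝ) (r γ₀ B M : ℝ), 0 < γ₀ ∧ RunConstRemainder (betaOfRecord₁₃ F 2 θ.toStage13Params) b r γ₀ ∧ (∀ k, b k ≤ B) ∧ B + r ≤ w.βup ∧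
        (∀ (n : ℕ) (gs : ℕ → ℝ), RGEqH n (betaOfRecord₁₃ F 2 θ.toStage13Params) gs → Step.InInterval γ₀ n gs →
          ∀ k, k ≤ n → -M ≤ ∑ j ∈ Finset.Ico k n, betaOfRecord₁₃ F 2 θ.toStage13Params j (prefixOf gs j)) ∧
        SurvCont (betaOfRecord₁₃ F 2 θ.toStage13Params) γ₀) :
    Summit.QuantumFields.YangMills.Theses.BalabanUVNodes.StabilityBRunRowsAtRecordR13SepCoPHV :=
  fun F hinh => stabilityBRunRowsAtRecordR13SepCoPHV_of_stubTextsV (h₁ F) (h₂ F) hinh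


/-- **★★★ THE ROUTE DECL BY NAME FROM THE LAST RUNG OF A «LINE 2» STUB CHAIN** (the ∃→∃ idiom of v6∕v7ᴿ∕v8: stub 1ⱽ ∘ stub 2″ⱽ ∘ stub 3ⱽ composed into ONE letter «rung 0 ⟹ SOME
`(θ, h, v, w)` with unity∕slots, admissibility, the `RecordSⱽ` text, the thirteen nodes at every run, the run rows of `β_θ` on some level `γ₀` AND (C) there»): §2 at that witness, rows (i)(iv)(C)
read off the bundle — i.e. v8's `k1R9_of_stubs` with the `refl` door replaced by the witness's own slot.  CONDITIONAL (the letter is a HYPOTHESIS); closes NO stub; registers nothing.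
[cite: Balaban1989LargeFieldII, Thm 1 + (0.1) pp.355–356; Balaban1987RG1, Thm 3 p.264, §1 pp.263–264 (statement shapes only)] -/
theorem stabilityBRunRowsAtRecordR13SepCoPHV_byName_of_rowsContWitnessV
    (h : ∀ F : T4Family, (∃ θ : Stage13HParams F 2, θ.Provisos₁₃SepCoPH F 2 ∧ (θ.ZhUnity F 2 ∧ θ.SlotsNondegenerate₁₃ F 2) ∧ θ.Admissible F 2) →
      ∃ (θ : Stage13HParams F 2) (h : θ.Provisos₁₃SepCoPH F 2) (v : Revision₁₃ F 2 θ h) (w : WorldP), (θ.ZhUnity F 2 ∧ θ.SlotsNondegenerate₁₃ F 2) ∧ θ.Admissible F 2 ∧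
        (∃ (θ' : Stage13HParams F 2) (h' : θ'.Provisos₁₃SepCoPH F 2), θ'.Admissible F 2 ∧
          datumOfRecord₁₃SepCoPH F 2 θ h = datumOfRecord₁₃SepCoPH F 2 θ' h' ∧ w.C = (datumOfRecord₁₃SepCoPHV F 2 θ h v).C ∧ (0 < w.γ ∧ w.γ ≤ θ'.γ) ∧
          w.L = (θ'.L : ℝ) ∧ ∀ P : B12.RunParams, w.up P = upOfRecord₅CS F 2 (θ'.toStage5₁₃CoPH F 2) P) ∧
        (∀ P : B12.RunParams, Nodes (leavesP w P)) ∧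
        ∃ (b : ℕ → ℝ) (r γ₀ B M : ℝ), 0 < γ₀ ∧ RunConstRemainder (betaOfRecord₁₃ F 2 θ.toStage13Params) b r γ₀ ∧ (∀ k, b k ≤ B) ∧ B + r ≤ w.βup ∧
          (∀ (n : ℕ) (gs : ℕ → ℝ), RGEqH n (betaOfRecord₁₃ F 2 θ.toStage13Params) gs → Step.InInterval γ₀ n gs →
            ∀ k, k ≤ n → -M ≤ ∑ j ∈ Finset.Ico k n, betaOfRecord₁₃ F 2 θ.toStage13Params j (prefixOf gs j)) ∧
          SurvCont (betaOfRecord₁₃ F 2 θ.toStage13Params) γ₀) :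
    Summit.QuantumFields.YangMills.Theses.BalabanUVNodes.StabilityBRunRowsAtRecordR13SepCoPHV := by
  intro F hinh
  obtain ⟨θ, hθP, v, w, hU, hθ, hRV, hnodes, b, r, γ₀, B, M, hγ₀, hrem, hB, hmatch, hps, hsc⟩ := h F hinh
  obtain ⟨hU', hθ', hb, hwin⟩ := stabilityBV_body_of_rung1AtV_of_runLetters θ hθP v w hU hθ hRV hnodes hγ₀ hrem hB hmatch hps
  exact ⟨θ, hθP, v, hU', hθ', hb, hwin, b, r, γ₀, M, hγ₀, hrem, hps, hsc⟩

end Line2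

/-! ## §4. ★★ N13's entry at the revised world discharged by the slot's Cor-3 conjunct, BINDING-AGNOSTIC (any up-block with its 𝐑-leaf): nodes at the REBOUND twin + `Cor3With (datumⱽ v).C γ₁ w.em w.ep` ⟹ the body -/

section WithN13

/-- **N13 AT THE REVISED-RECORD WORLD, BINDING-AGNOSTIC** (companion of p624688 §3, which is keyed to the C-binding `upOfRecord₅C`): for ANY up-block with its 𝐑-leaf `(w.up P).rOperation` (the engines
read it through their own `rOperation_iff_of_upS_…` lemmas at the pinned S-bindings), `w.C = (datumⱽ v).C`, `w.γ ≤ γ₁` and `B16.Cor3With (datumOfRecord₁₃SepCoPHV F N θ h v).C γ₁ w.em w.ep` ⟹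
`Dag.B16_main (leavesP w P)` — module 13's `uvSlot_at_construction` at `ρ := v.ρ` (trivial representation, `Laws := SLaw₁₃CoPH`) under `b16_main_of_rOperation_of_uvSlot`. HYPOTHESES displayed; count-neutral.
[cite: Balaban1989LargeFieldII, Thm 1 p.355, (0.1) pp.355–356, p.387; Balaban1988Convergent, Cor. 3 (2.50) p.264 (bookkeeping)] -/
theorem b16_main_at_recordV₁₃_of_rOperation_of_cor3With (θ : Stage13HParams F N) (h : θ.Provisos₁₃SepCoPH F N) (v : Revision₁₃ F N θ h) (w : WorldP) (P : B12.RunParams)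
    (hC : w.C = (datumOfRecord₁₃SepCoPHV F N θ h v).C) (hRop : (w.up P).rOperation) {γ₁ : ℝ} (hγ : w.γ ≤ γ₁)
    (hcor : B16.Cor3With (datumOfRecord₁₃SepCoPHV F N θ h v).C γ₁ w.em w.ep) : Dag.B16_main (leavesP w P) :=
  b16_main_of_rOperation_of_uvSlot w P hRop
    (uvSlot_at_construction F N (coreOfRecord₁₃CoPH F N θ) v.ρ w P (Rep := fun _ => Unit) (fun _ => ()) (fun k _ => SLaw₁₃CoPH F N θ P k) (fun k _ => v.ρ P k)
      (hC.trans (datumOfRecord₁₃SepCoPHV_C F N θ h v)) (fun _ => rfl) (fun k _ hs => (sect2Form_coreOfRecord₁₃CoPH_iff F N θ P k).1 hs) hγ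
      (fun hP k hk _ U => (uvIneq_revision₁₃_iff F N θ h v P k U _ _).1 (hcor P ((flow_inInterval_revision₁₃_iff F N θ h v P γ₁).2 hP) k hk U)))

/-- **★★ THE BODY OF K1⁹ AT A `RecordSⱽ` WORLD WHOSE N13 ENTRY COMES FROM THE SLOT**: the thirteen nodes at the REBOUND twin `{w with C := (datumOfRecord₁₃SepCoPH θ h).C}` (any road — N13 there is
DROPPED by p624688's `nodes_update_uvBounds`, only the other twelve are used), the 𝐑-leaf `(w.up P).rOperation` at every run, the Cor-3 conjunct `B16.Cor3With (datumOfRecord₁₃SepCoPHV F N θ h v).C γ₁ w.em w.ep`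
AT THE REVISED DATUM with `w.γ ≤ γ₁`, and the run letters ⟹ the (B)+window body at `(θ, h, v)` (§2 with N13 at the revised world from the lemma above and p624688 §5).  LOCATED: on such a line the
UNREVISED N13 pin (`Cor3With (datumOfRecord₁₃SepCoPH θ h).C …`, decided by density versions) is NEVER asked; what IS asked of N13 is `Cor3With` at the REVISED datum — the slot chain's output from
Theorem 1 + the version-free rows (a.e. ∕ measure).  CONDITIONAL; closes nothing. [cite: Balaban1989LargeFieldII, Thm 1 p.355 + (0.1) pp.355–356, p.387; Balaban1988Convergent, Cor. 3 (2.50) p.264; Balaban1987RG1, Thm 3 p.264 (bookkeeping)] -/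
theorem stabilityBV_body_of_rung1AtV_of_nodesRebound_of_cor3With_of_runLetters (θ : Stage13HParams F N) (h : θ.Provisos₁₃SepCoPH F N) (v : Revision₁₃ F N θ h) (w : WorldP)
    (hU : θ.ZhUnity F N ∧ θ.SlotsNondegenerate₁₃ F N) (hθ : θ.Admissible F N)
    (hRV : ∃ (θ' : Stage13HParams F N) (h' : θ'.Provisos₁₃SepCoPH F N), θ'.Admissible F N ∧
      datumOfRecord₁₃SepCoPH F N θ h = datumOfRecord₁₃SepCoPH F N θ' h' ∧ w.C = (datumOfRecord₁₃SepCoPHV F N θ h v).C ∧ (0 < w.γ ∧ w.γ ≤ θ'.γ) ∧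
      w.L = (θ'.L : ℝ) ∧ ∀ P : B12.RunParams, w.up P = upOfRecord₅CS F N (θ'.toStage5₁₃CoPH F N) P)
    (hnodes₀ : ∀ P : B12.RunParams, Nodes (leavesP { w with C := (datumOfRecord₁₃SepCoPH F N θ h).C } P))
    (hRop : ∀ P : B12.RunParams, (w.up P).rOperation)
    {γ₁ : ℝ} (hγ : w.γ ≤ γ₁) (hcor : B16.Cor3With (datumOfRecord₁₃SepCoPHV F N θ h v).C γ₁ w.em w.ep)
    {b : ℕ → ℝ} {r γ₀ B M : ℝ} (hγ₀ : 0 < γ₀) (hrem : RunConstRemainder (betaOfRecord₁₃ F N θ.toStage13Params) b r γ₀) (hB : ∀ k, b k ≤ B) (hmatch : B + r ≤ w.βup)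
    (hps : ∀ (n : ℕ) (gs : ℕ → ℝ), RGEqH n (betaOfRecord₁₃ F N θ.toStage13Params) gs → Step.InInterval γ₀ n gs →
      ∀ k, k ≤ n → -M ≤ ∑ j ∈ Finset.Ico k n, betaOfRecord₁₃ F N θ.toStage13Params j (prefixOf gs j)) :
    (θ.ZhUnity F N ∧ θ.SlotsNondegenerate₁₃ F N) ∧ θ.Admissible F N ∧ B16.EndStatementBPrinted (datumOfRecord₁₃SepCoPHV F N θ h v).C ∧
      ∃ γ₁ : ℝ, 0 < γ₁ ∧ ∀ γ : ℝ, 0 < γ → γ ≤ γ₁ → ∃ P : B12.RunParams, 1 ≤ P.K ∧ ((datumOfRecord₁₃SepCoPHV F N θ h v).C P).flow.InInterval γ P.K := by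
  have hC : w.C = (datumOfRecord₁₃SepCoPHV F N θ h v).C := by
    obtain ⟨-, -, -, -, hC, -⟩ := hRV
    exact hC
  exact stabilityBV_body_of_rung1AtV_of_runLetters θ h v w hU hθ hRV
    (fun P => nodes_at_recordV₁₃_of_nodes_rebound_of_b16 F N θ h v w P hC (hnodes₀ P)
      (b16_main_at_recordV₁₃_of_rOperation_of_cor3With θ h v w P hC (hRop P) hγ hcor)) hγ₀ hrem hB hmatch hps

end WithN13

end Summit.QuantumFields.YangMills.BalabanUVNodes.K1R9BodyAtRevisedRecordWorldOfNodesRunLetters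

end
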